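import Summits.Ventures.HSemireg.WeilFrameRealCarrierDegrees
import Summits.Ventures.HSemireg.Mod4EightfoldPins

/-!
# Venture HSemireg — THE EIGHTFOLD `ch(O_Z)`-SHAPE ROW ON THE REAL CARRIER AT ITS PINS `q₄²` AND `16q₄²`: MIDDLE ENTRY `478` OR `479`
# EXACTLY ACCORDING TO TWO POLYNOMIAL CONDITIONS ON THE TAIL (`5q₄q₆ = 3q₅²`; the weight-20 quartic) — THEOREM A₈'s row decided

HONEST FRAMING. Part of the Lean index of the computation cell `pub-hsemireg` (seat w3-mod4-1 gen 14, W3 SPECIAL FIBRES;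
MOD4-OFFSPLIT §8 (n = 4, kit j179422: «R = (1,16,104,304,480,304,104,16,1), drops 478 (pure middle) / 479 (generic O_Z) at the locus
ab = q₄²», THEOREM A₈) and §13.25–13.26). The tree's real carriers and the Literature's Weil-type layer ONLY: no semiregularity map, no
Ext group, no `∫`; nothing here says that HC / HC_CM / HC_AV holds; nothing here is a claim about any explicit variety or cycle; no
Literature fact is declared; NO definition is introduced. Imports: FILE 13 `WeilFrameRealCarrierDegrees` (built) + `Mod4EightfoldPins`.

WHAT IS PROVED, for `A : AbelianVariety ℂ` of dimension `8`, `φ ≫ φ = -(d • 𝟙 A)`, `d ≥ 1`, `P, Q` the `±i√d`-eigenspaces,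
`dim (P ⊓ H^{1,0}) = 4`, `h` `K`-symmetric of type `(1,1)` with `ĥ⁸ ≠ 0`, non-zero `c± ∈ E±`, the class
`x = Σ_{m ≤ 8} (q_m/m!) ĥ^m + ĉ₊ + ĉ₋` with `q_0 = q_1 = q_2 = q_3 = 0`, `q_4 ≠ 0`, ANY `q_5, …, q_8`, and the pin `8!·(ĉ₊ĉ₋) = t·ĥ⁸`:
* **`finrank_S_four_pin_one_of_eq`** ∕ **`…_of_ne`** — `t = 16q₄²`: `dim S_4(x) = 478` if `5q₄q₆ = 3q₅²`, else `479`;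
* **`finrank_S_four_pin_zero_of_eq`** ∕ **`…_of_ne`** — `t = q₄²`: `dim S_4(x) = 478` if
  `125q₄³q₈ + 320q₄q₅²q₆ = 96q₅⁴ + 150q₄²q₆² + 200q₄²q₅q₇`, else `479`
(FILE 13's `finrank_S_weilType_middle` with `r_4 = 5` (`Mod4LeadingTermMiddle`) and `dim ker(M_f − t) ∈ {2, 1}` (`Mod4EightfoldPins`);
`7·C(8,4) − 10 = 480`). With `Mod4LeadingTermPins` (`479` at the self-dual pin `36q₄²`), `WeilFrameLeadingTermMiddle` (`480` off the pins),
`WeilFrameLeadingTerm` ∕ `…Upper` (sides `16, 104, 304`) the whole eightfold `ch(O_Z)`-shape row of TABLE R is kernel, and its Euler-pin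
value `R(−1) = R_4 − 430 ∈ {48, 49, 50}` is read off `ch₄, …, ch₈`. Everything PROVED, 0 sorry.
References: [BuchweitzFlenner2008HH] Prop. 6.4.4; [vanGeemen1994HodgeAV] 4.9, Lemma 5.2; [BourbakiAlgebre1a3] Ch. III §8, §11 no. 9.
-/

noncomputable section

open CliffordAlgebra (contractLeft)
open ExteriorAlgebra (ι)
open Module CategoryTheory
open Literature.AlgebraicGeometry.Motives Literature.AlgebraicGeometry.HodgeTheory
open Literature.AlgebraicTopology.SingularHomology

namespace Summit.Ventures.HSemireg.WeilFrame

open Summit.Ventures.HSemireg.WedgeBridge Summit.Ventures.HSemireg.WeilCarrier Summit.Ventures.HSemireg.Mod4Carrier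
open Summit.Ventures.HSemireg.Wedge.Hankel

section RealCarrier

variable {A : AbelianVariety ℂ}

/-- **EIGHTFOLD `ch(O_Z)`-shape row at the pin `t = 16q₄²`, degenerate tail `5q₄q₆ = 3q₅²`:** `dim S_4(x) = 478`.
[cite: BuchweitzFlenner2008HH, Prop. 6.4.4] [cite: vanGeemen1994HodgeAV, 4.9 and Lemma 5.2] -/
theorem finrank_S_four_pin_one_of_eq (hA : IsSmoothProjective A.dim A.X) {d : ℕ} (hdim : A.dim = 4 + 4) (hd : 0 < d)
    {φ : A ⟶ A} (hφ : φ ≫ φ = -(d • 𝟙 A)) {P Q : Submodule ℂ (complexBetti A.X 1)}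
    (hP : P = Module.End.eigenspace (complexBetti.map φ.hom.hom.hom 1).hom (Complex.I * (Real.sqrt d : ℂ)))
    (hQ : Q = Module.End.eigenspace (complexBetti.map φ.hom.hom.hom 1).hom (-(Complex.I * (Real.sqrt d : ℂ))))
    (hp : finrank ℂ ↥(P ⊓ hodgeOneZero hA) = 4) {h : complexBetti A.X 2}
    (hh : complexBetti.map φ.hom.hom.hom 2 h = (d : ℂ) • h) (h11 : IsOfHodgeType A.dim A.X 2 1 1 h)
    (hvol : ((⋀[ℂ]^2 (complexBetti A.X 1)).subtype ((abelianVarietyCohomologyExteriorH1_holds.equiv A 2).symm h)) ^ (4 + 4) ≠ 0)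
    {cP cQ : complexBetti A.X (2 * 4)} (hcP : cP ∈ weilClassesPlus A φ 4 d) (hcP0 : cP ≠ 0)
    (hcQ : cQ ∈ weilClassesMinus A φ 4 d) (hcQ0 : cQ ≠ 0)
    {q : ℕ → ℂ} (hq0 : q 0 = 0) (hq1 : q 1 = 0) (hq2 : q 2 = 0) (hq3 : q 3 = 0) (hq4 : q 4 ≠ 0) {t : ℂ}
    (ht : (((4 + 4).factorial : ℕ) : ℂ) •
        ((⋀[ℂ]^(2 * 4) (complexBetti A.X 1)).subtype ((abelianVarietyCohomologyExteriorH1_holds.equiv A (2 * 4)).symm cP) *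
          (⋀[ℂ]^(2 * 4) (complexBetti A.X 1)).subtype ((abelianVarietyCohomologyExteriorH1_holds.equiv A (2 * 4)).symm cQ)) =
      t • ((⋀[ℂ]^2 (complexBetti A.X 1)).subtype ((abelianVarietyCohomologyExteriorH1_holds.equiv A 2).symm h)) ^ (4 + 4))
    (hpin : t = 16 * (q 4 * q 4)) (hc : 5 * q 4 * q 6 = 3 * (q 5 * q 5)) :
    finrank ℂ ↥(S ℂ (hodgeZeroOne hA) 4
        ((∑ m ∈ Finset.range (4 + 4 + 1), (q m * ((m.factorial : ℕ) : ℂ)⁻¹) •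
            ((⋀[ℂ]^2 (complexBetti A.X 1)).subtype ((abelianVarietyCohomologyExteriorH1_holds.equiv A 2).symm h)) ^ m) +
          (⋀[ℂ]^(2 * 4) (complexBetti A.X 1)).subtype ((abelianVarietyCohomologyExteriorH1_holds.equiv A (2 * 4)).symm cP) +
          (⋀[ℂ]^(2 * 4) (complexBetti A.X 1)).subtype ((abelianVarietyCohomologyExteriorH1_holds.equiv A (2 * 4)).symm cQ))) = 478 := by
  haveI : Module.Finite ℂ (complexBetti A.X 1) := abelianVarietyCohomologyExteriorH1_holds.finite_one A
  have hq0' : ∀ m, m < 4 → q m = 0 := by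
    intro m hm
    interval_cases m
    · exact hq0
    · exact hq1
    · exact hq2
    · exact hq3
  have h := finrank_S_weilType_middle hA hdim hd hφ hP hQ hp hh h11 hvol hcP hcP0 hcQ hcQ0 (by norm_num) q ht
  rw [Mod4.hankel1_rank_leading_middle hq0' hq4, Mod4.finrank_ker_middleM_four_pin_one_of_eq hq0 hq1 hq2 hq3 hq4 hpin hc] at h
  have e : (4 + 4).choose 4 = 70 := by decide
  rw [e] at h
  omega

/-- **EIGHTFOLD `ch(O_Z)`-shape row at the pin `t = 16q₄²`, generic tail `5q₄q₆ ≠ 3q₅²`:** `dim S_4(x) = 479`.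
[cite: BuchweitzFlenner2008HH, Prop. 6.4.4] [cite: vanGeemen1994HodgeAV, 4.9 and Lemma 5.2] -/
theorem finrank_S_four_pin_one_of_ne (hA : IsSmoothProjective A.dim A.X) {d : ℕ} (hdim : A.dim = 4 + 4) (hd : 0 < d)
    {φ : A ⟶ A} (hφ : φ ≫ φ = -(d • 𝟙 A)) {P Q : Submodule ℂ (complexBetti A.X 1)}
    (hP : P = Module.End.eigenspace (complexBetti.map φ.hom.hom.hom 1).hom (Complex.I * (Real.sqrt d : ℂ)))
    (hQ : Q = Module.End.eigenspace (complexBetti.map φ.hom.hom.hom 1).hom (-(Complex.I * (Real.sqrt d : ℂ))))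
    (hp : finrank ℂ ↥(P ⊓ hodgeOneZero hA) = 4) {h : complexBetti A.X 2}
    (hh : complexBetti.map φ.hom.hom.hom 2 h = (d : ℂ) • h) (h11 : IsOfHodgeType A.dim A.X 2 1 1 h)
    (hvol : ((⋀[ℂ]^2 (complexBetti A.X 1)).subtype ((abelianVarietyCohomologyExteriorH1_holds.equiv A 2).symm h)) ^ (4 + 4) ≠ 0)
    {cP cQ : complexBetti A.X (2 * 4)} (hcP : cP ∈ weilClassesPlus A φ 4 d) (hcP0 : cP ≠ 0)
    (hcQ : cQ ∈ weilClassesMinus A φ 4 d) (hcQ0 : cQ ≠ 0)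
    {q : ℕ → ℂ} (hq0 : q 0 = 0) (hq1 : q 1 = 0) (hq2 : q 2 = 0) (hq3 : q 3 = 0) (hq4 : q 4 ≠ 0) {t : ℂ}
    (ht : (((4 + 4).factorial : ℕ) : ℂ) •
        ((⋀[ℂ]^(2 * 4) (complexBetti A.X 1)).subtype ((abelianVarietyCohomologyExteriorH1_holds.equiv A (2 * 4)).symm cP) *
          (⋀[ℂ]^(2 * 4) (complexBetti A.X 1)).subtype ((abelianVarietyCohomologyExteriorH1_holds.equiv A (2 * 4)).symm cQ)) =
      t • ((⋀[ℂ]^2 (complexBetti A.X 1)).subtype ((abelianVarietyCohomologyExteriorH1_holds.equiv A 2).symm h)) ^ (4 + 4))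
    (hpin : t = 16 * (q 4 * q 4)) (hc : 5 * q 4 * q 6 ≠ 3 * (q 5 * q 5)) :
    finrank ℂ ↥(S ℂ (hodgeZeroOne hA) 4
        ((∑ m ∈ Finset.range (4 + 4 + 1), (q m * ((m.factorial : ℕ) : ℂ)⁻¹) •
            ((⋀[ℂ]^2 (complexBetti A.X 1)).subtype ((abelianVarietyCohomologyExteriorH1_holds.equiv A 2).symm h)) ^ m) +
          (⋀[ℂ]^(2 * 4) (complexBetti A.X 1)).subtype ((abelianVarietyCohomologyExteriorH1_holds.equiv A (2 * 4)).symm cP) +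
          (⋀[ℂ]^(2 * 4) (complexBetti A.X 1)).subtype ((abelianVarietyCohomologyExteriorH1_holds.equiv A (2 * 4)).symm cQ))) = 479 := by
  haveI : Module.Finite ℂ (complexBetti A.X 1) := abelianVarietyCohomologyExteriorH1_holds.finite_one A
  have hq0' : ∀ m, m < 4 → q m = 0 := by
    intro m hm
    interval_cases m
    · exact hq0
    · exact hq1
    · exact hq2
    · exact hq3
  have h := finrank_S_weilType_middle hA hdim hd hφ hP hQ hp hh h11 hvol hcP hcP0 hcQ hcQ0 (by norm_num) q ht
  rw [Mod4.hankel1_rank_leading_middle hq0' hq4, Mod4.finrank_ker_middleM_four_pin_one_of_ne hq0 hq1 hq2 hq3 hq4 hpin hc] at h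
  have e : (4 + 4).choose 4 = 70 := by decide
  rw [e] at h
  omega

/-- **EIGHTFOLD `ch(O_Z)`-shape row at the pin `t = q₄²`, degenerate tail (the weight-20 quartic vanishes):** `dim S_4(x) = 478`.
[cite: BuchweitzFlenner2008HH, Prop. 6.4.4] [cite: vanGeemen1994HodgeAV, 4.9 and Lemma 5.2] -/
theorem finrank_S_four_pin_zero_of_eq (hA : IsSmoothProjective A.dim A.X) {d : ℕ} (hdim : A.dim = 4 + 4) (hd : 0 < d)
    {φ : A ⟶ A} (hφ : φ ≫ φ = -(d • 𝟙 A)) {P Q : Submodule ℂ (complexBetti A.X 1)}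
    (hP : P = Module.End.eigenspace (complexBetti.map φ.hom.hom.hom 1).hom (Complex.I * (Real.sqrt d : ℂ)))
    (hQ : Q = Module.End.eigenspace (complexBetti.map φ.hom.hom.hom 1).hom (-(Complex.I * (Real.sqrt d : ℂ))))
    (hp : finrank ℂ ↥(P ⊓ hodgeOneZero hA) = 4) {h : complexBetti A.X 2}
    (hh : complexBetti.map φ.hom.hom.hom 2 h = (d : ℂ) • h) (h11 : IsOfHodgeType A.dim A.X 2 1 1 h)
    (hvol : ((⋀[ℂ]^2 (complexBetti A.X 1)).subtype ((abelianVarietyCohomologyExteriorH1_holds.equiv A 2).symm h)) ^ (4 + 4) ≠ 0)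
    {cP cQ : complexBetti A.X (2 * 4)} (hcP : cP ∈ weilClassesPlus A φ 4 d) (hcP0 : cP ≠ 0)
    (hcQ : cQ ∈ weilClassesMinus A φ 4 d) (hcQ0 : cQ ≠ 0)
    {q : ℕ → ℂ} (hq0 : q 0 = 0) (hq1 : q 1 = 0) (hq2 : q 2 = 0) (hq3 : q 3 = 0) (hq4 : q 4 ≠ 0) {t : ℂ}
    (ht : (((4 + 4).factorial : ℕ) : ℂ) •
        ((⋀[ℂ]^(2 * 4) (complexBetti A.X 1)).subtype ((abelianVarietyCohomologyExteriorH1_holds.equiv A (2 * 4)).symm cP) *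
          (⋀[ℂ]^(2 * 4) (complexBetti A.X 1)).subtype ((abelianVarietyCohomologyExteriorH1_holds.equiv A (2 * 4)).symm cQ)) =
      t • ((⋀[ℂ]^2 (complexBetti A.X 1)).subtype ((abelianVarietyCohomologyExteriorH1_holds.equiv A 2).symm h)) ^ (4 + 4))
    (hpin : t = q 4 * q 4) (hc : 125 * q 4 ^ 3 * q 8 + 320 * q 4 * q 5 ^ 2 * q 6 = 96 * q 5 ^ 4 + 150 * q 4 ^ 2 * q 6 ^ 2 + 200 * q 4 ^ 2 * q 5 * q 7) :
    finrank ℂ ↥(S ℂ (hodgeZeroOne hA) 4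
        ((∑ m ∈ Finset.range (4 + 4 + 1), (q m * ((m.factorial : ℕ) : ℂ)⁻¹) •
            ((⋀[ℂ]^2 (complexBetti A.X 1)).subtype ((abelianVarietyCohomologyExteriorH1_holds.equiv A 2).symm h)) ^ m) +
          (⋀[ℂ]^(2 * 4) (complexBetti A.X 1)).subtype ((abelianVarietyCohomologyExteriorH1_holds.equiv A (2 * 4)).symm cP) +
          (⋀[ℂ]^(2 * 4) (complexBetti A.X 1)).subtype ((abelianVarietyCohomologyExteriorH1_holds.equiv A (2 * 4)).symm cQ))) = 478 := by
  haveI : Module.Finite ℂ (complexBetti A.X 1) := abelianVarietyCohomologyExteriorH1_holds.finite_one A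
  have hq0' : ∀ m, m < 4 → q m = 0 := by
    intro m hm
    interval_cases m
    · exact hq0
    · exact hq1
    · exact hq2
    · exact hq3
  have h := finrank_S_weilType_middle hA hdim hd hφ hP hQ hp hh h11 hvol hcP hcP0 hcQ hcQ0 (by norm_num) q ht
  rw [Mod4.hankel1_rank_leading_middle hq0' hq4, Mod4.finrank_ker_middleM_four_pin_zero_of_eq hq0 hq1 hq2 hq3 hq4 hpin hc] at h
  have e : (4 + 4).choose 4 = 70 := by decide
  rw [e] at h
  omega

/-- **EIGHTFOLD `ch(O_Z)`-shape row at the pin `t = q₄²`, generic tail (the weight-20 quartic does not vanish):** `dim S_4(x) = 479`.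
[cite: BuchweitzFlenner2008HH, Prop. 6.4.4] [cite: vanGeemen1994HodgeAV, 4.9 and Lemma 5.2] -/
theorem finrank_S_four_pin_zero_of_ne (hA : IsSmoothProjective A.dim A.X) {d : ℕ} (hdim : A.dim = 4 + 4) (hd : 0 < d)
    {φ : A ⟶ A} (hφ : φ ≫ φ = -(d • 𝟙 A)) {P Q : Submodule ℂ (complexBetti A.X 1)}
    (hP : P = Module.End.eigenspace (complexBetti.map φ.hom.hom.hom 1).hom (Complex.I * (Real.sqrt d : ℂ)))
    (hQ : Q = Module.End.eigenspace (complexBetti.map φ.hom.hom.hom 1).hom (-(Complex.I * (Real.sqrt d : ℂ))))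
    (hp : finrank ℂ ↥(P ⊓ hodgeOneZero hA) = 4) {h : complexBetti A.X 2}
    (hh : complexBetti.map φ.hom.hom.hom 2 h = (d : ℂ) • h) (h11 : IsOfHodgeType A.dim A.X 2 1 1 h)
    (hvol : ((⋀[ℂ]^2 (complexBetti A.X 1)).subtype ((abelianVarietyCohomologyExteriorH1_holds.equiv A 2).symm h)) ^ (4 + 4) ≠ 0)
    {cP cQ : complexBetti A.X (2 * 4)} (hcP : cP ∈ weilClassesPlus A φ 4 d) (hcP0 : cP ≠ 0)
    (hcQ : cQ ∈ weilClassesMinus A φ 4 d) (hcQ0 : cQ ≠ 0)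
    {q : ℕ → ℂ} (hq0 : q 0 = 0) (hq1 : q 1 = 0) (hq2 : q 2 = 0) (hq3 : q 3 = 0) (hq4 : q 4 ≠ 0) {t : ℂ}
    (ht : (((4 + 4).factorial : ℕ) : ℂ) •
        ((⋀[ℂ]^(2 * 4) (complexBetti A.X 1)).subtype ((abelianVarietyCohomologyExteriorH1_holds.equiv A (2 * 4)).symm cP) *
          (⋀[ℂ]^(2 * 4) (complexBetti A.X 1)).subtype ((abelianVarietyCohomologyExteriorH1_holds.equiv A (2 * 4)).symm cQ)) =
      t • ((⋀[ℂ]^2 (complexBetti A.X 1)).subtype ((abelianVarietyCohomologyExteriorH1_holds.equiv A 2).symm h)) ^ (4 + 4))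
    (hpin : t = q 4 * q 4) (hc : 125 * q 4 ^ 3 * q 8 + 320 * q 4 * q 5 ^ 2 * q 6 ≠ 96 * q 5 ^ 4 + 150 * q 4 ^ 2 * q 6 ^ 2 + 200 * q 4 ^ 2 * q 5 * q 7) :
    finrank ℂ ↥(S ℂ (hodgeZeroOne hA) 4
        ((∑ m ∈ Finset.range (4 + 4 + 1), (q m * ((m.factorial : ℕ) : ℂ)⁻¹) •
            ((⋀[ℂ]^2 (complexBetti A.X 1)).subtype ((abelianVarietyCohomologyExteriorH1_holds.equiv A 2).symm h)) ^ m) +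
          (⋀[ℂ]^(2 * 4) (complexBetti A.X 1)).subtype ((abelianVarietyCohomologyExteriorH1_holds.equiv A (2 * 4)).symm cP) +
          (⋀[ℂ]^(2 * 4) (complexBetti A.X 1)).subtype ((abelianVarietyCohomologyExteriorH1_holds.equiv A (2 * 4)).symm cQ))) = 479 := by
  haveI : Module.Finite ℂ (complexBetti A.X 1) := abelianVarietyCohomologyExteriorH1_holds.finite_one A
  have hq0' : ∀ m, m < 4 → q m = 0 := by
    intro m hm
    interval_cases m
    · exact hq0
    · exact hq1
    · exact hq2
    · exact hq3
  have h := finrank_S_weilType_middle hA hdim hd hφ hP hQ hp hh h11 hvol hcP hcP0 hcQ hcQ0 (by norm_num) q ht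
  rw [Mod4.hankel1_rank_leading_middle hq0' hq4, Mod4.finrank_ker_middleM_four_pin_zero_of_ne hq0 hq1 hq2 hq3 hq4 hpin hc] at h
  have e : (4 + 4).choose 4 = 70 := by decide
  rw [e] at h
  omega

end RealCarrier

end Summit.Ventures.HSemireg.WeilFrame

end
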